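import Literature.MathematicalPhysics.QuantumFieldTheory.Balaban1983to89.T3SectALandauChart
import HarnessLib

/-!
# Route `UnitScaleTilt`, crux K1 child «MinimiserStabilityRegPr» (stmt-QuantumFields-19200), registered stub `stub_prop7From14` (skeleton birth_v7
# cc37a178…; leaf V3 «Prop 7 from a background (14)») — [Balaban1985Variational] SECT. A, p. 281 «THE ABOVE MAPPING IS ONE-TO-ONE»: THE KNIT
# `T3SectALandauChart.prop7From14At_of_props` RE-ASSEMBLED WITH PRINT'S INJECTIVITY LAW IN PLACE OF THE LQB LAW `Orbit16`

Cell `ym3-torus` ∕ fleet seat `ym-ust-19200-p1` (gen 8; HUMAN RULING D-0037, YM ladder rung R3; director-ym 2026-08-27 20:03Z (ii) «the one-to-one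
chart-map skeleton»).  WHY.  The owner's v8 re-cut of V3 runs along the typed knit `T3SectALandauChart.prop7From14At_of_props_of_located`: V3 ⇐
Props 2, 5, 6 at a concrete presentation `S₀` + two PRESENTED laws, `AxialRepr S₀` (proved for the comb gauge by gen 7, `Prop7AxialGauge.axialRepr_comb`)
and `Orbit16 S₀`.  LOCATED HERE: the LQB law `Orbit16` — «for EVERY perturbation `U₁` and ANY two restricted `u, u′` the images `(U₁U₀)^u`,
`(U₁U₀)^{u′}` lie on one orbit of the group (4)» — is NOT what print says and is not satisfiable by an honest presentation: the restriction (1.29)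
∕ [Balaban1985Averaging] (81) «(R̄₀uᵏ)(y) = 1» is a condition on block AVERAGES of `u` ([Balaban1985RegularSpaces] p. 80 «they do not agree with
the group structure»), so two restricted `u, u′` need not agree at the `k`-centres, while `(U₁U₀)^{u′} = ((U₁U₀)^u)^{u′u⁻¹}` lies on the (4)-orbit of
`(U₁U₀)^u` only if `u′u⁻¹` is (4)-trivial modulo the stabiliser of the configuration.  What PRINT says (p. 281, after (21)): «These gauge
transformations define a mapping of the space (18) into a space of gauge field configurations U₁U₀ with U₁ satisfying the conditions (19)–(21) …
The above mapping is one-to-one», resting on [Balaban1985Averaging] p. 31 «Thus the gauge transformation is uniquely determined by all the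
conditions [(67) = the axial gauge of `U′ = U₁^u` and (81) = the restriction] and is given by the formulas (77) for j = k − 1 and by (87)» — i.e.
the law WITH THE HYPOTHESIS THAT BOTH IMAGES LIE IN THE SPACE (18): if `u, u′` are restricted and `(U₁U₀)^u`, `(U₁U₀)^{u′}` are both in the axial
gauge relative to `U₀`, then `u = u′` (hence the images coincide).  And THAT is all `B11Prop7Assembly.atMostOneCriticalOrbit_of_props` ever uses
(its two images come from Prop. 2 applied to elements of (18)).  Likewise the axial-representative law is only ever used for `U ∈ (6)(ε₀)`,
`U₀` with (14), `ε₀` small — the regime in which print's ITERATED axial gauge (1.19) (averages of `U` at the levels `n < k`) is constructed.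

WHAT IS PROVED (sorry-free, no definition, no new hypothesis schema — the laws are displayed hypotheses of the theorems).
§1 `atMostOneCriticalOrbit_of_props_inj` — `B11Prop7Assembly.atMostOneCriticalOrbit_of_props` (clause (i) of Prop. 7 from Props 2, 5, 6 over ANY
   bridged family) RE-PROVED verbatim with (a) the WEAK orbit law (both images in (18)) in place of `Bridge.Laws.orbit16`, (b) the gauge-fixing law
   only for `ε₀ ≤ e` (a threshold `e > 0` folded into `a₀ := min{e, a₄/(16B₁C₁), c₁/(2C₁), c/(8B₁C₁)}`); reflexivity of «one orbit» is derived
   from `symm`/`trans` at the related pair that `gaugeFix` supplies.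
§2 AT THE T³ OBJECTS: `sameOrbit_of_eq_law` (print's «u = u′» law ⇒ the weak orbit law, by `T3SectALandauChart.sameOrbit_refl`),
   `gaugeFix_of_conditional_axialRepr` (the p. 280 reduction to (18) from a CONDITIONAL axial-representative law: only for `U ∈ (6)(ε₀)`, `U₀` with
   (14) at radii `(C₁B₃ε₁, C₁ε₁)`, `ε₀ ≤ e`), **`prop7From14At_of_props_orbitw`** (`T3Thm1CarrierNative.Prop7From14At L B₃` ⇐ `Prop2Printed ∧
   Prop5Printed ∧ Prop6Printed` at `famLG3 L S` + capped existence leaves + the CONDITIONAL axial law + the WEAK ORBIT LAW, for every presentation `S`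
   — the corrected twin of `T3SectALandauChart.prop7From14At_of_props_of_located`) and **`prop7From14At_of_props_inj`** (the same with PRINT'S
   INJECTIVITY LAW «u = u′» — the form proved for print's presentation in the sibling file).
§3 `prop7From14At_of_props_orbitw_of_located`: the old inputs (`AxialRepr` unconditional, `Orbit16` strong) imply the new ones a fortiori — nothing
   the lineage proved is lost (`Prop7AxialGauge.axialRepr_comb` discharges the conditional axial law for the comb gauge).

HONEST SCOPE.  Bookkeeping only: Props 2, 5, 6 and the leaves remain HYPOTHESES (typed statements of record); the two laws remain hypotheses here and
are PROVED for print's presentation (`IsAxial` := [Balaban1985RegularSpaces] (1.19) = `B8Thm2SetupTorus.InAxT`, `Restricted` := (1.29) =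
`B8Thm2SetupTorus.Restr129T`) in the sibling file `UnitScaleTiltProp7ChartInjectivityPrint` (injectivity; pure algebra, `k`- and volume-uniform).
No refutation of `Orbit16` is filed (the located argument above is prose); nothing of [Balaban1985Variational]'s analysis is claimed; count-neutral
helper toward stmt-QuantumFields-19200 (`--supports`), not a proof of the stub.

References: T. Bałaban, CMP 102 (1985) 277–309 [Balaban1985Variational] ((4) p.278, (15)–(18) p.280, (19)–(21) and Prop. 2 p.281, (122) p.296, Prop. 7
p.299); CMP 99 (1985) 75–102 [Balaban1985RegularSpaces] ((1.14) p.78, (1.19) p.79, (1.29) p.81, p.80); CMP 98 (1985) 17–51 [Balaban1985Averaging]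
((67) p.29, (77)–(81) p.30, (84)–(87) pp.30–31).
-/

noncomputable section

namespace Summit.QuantumFields.YangMills.Theorems.Prop7ChartInjectivity

open Literature.MathematicalPhysics.QuantumFieldTheory.Balaban1983to89
open Literature.MathematicalPhysics.QuantumFieldTheory.Balaban1983to89.T3ContinuumYM3Torus
open Literature.MathematicalPhysics.QuantumFieldTheory.Balaban1983to89.T3UnitLawDensityEML (ℰp)
open Literature.MathematicalPhysics.QuantumFieldTheory.Balaban1983to89.T3DescentFibreTower
open Literature.MathematicalPhysics.QuantumFieldTheory.Balaban1983to89.T3PrintedRegularMinimiser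
open Literature.MathematicalPhysics.QuantumFieldTheory.Balaban1983to89.T3PrintedRegularOrbits (descTransf gaugeAct_mem_regFibrePr_iff_of_trivial)
open B11 (VarProblemX LGData Prop2Printed Prop5Printed Prop6Printed)
open B11Prop7Assembly (Bridge ExistenceLeavesCap one_landau_of_props silent_restrictions eps2_ge_prop2 ineq122_le second_condition_auto)
open T3Thm1Carrier
open T3Thm1CarrierNative (IsCritR2 Prop7From14At)
open T3SectALandauChart

/-! ## §1 Clause (i) of Proposition 7 over a bridged family, with PRINT'S (weak) orbit law and a capped gauge-fixing law -/

section Generic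

variable {I : Type}

/-- **[Balaban1985Variational] PROPOSITION 7, CLAUSE (i), ASSEMBLED FROM PROPS 2, 5, 6 WITH PRINT'S INJECTIVITY LAW** — the twin of
`B11Prop7Assembly.atMostOneCriticalOrbit_of_props` in which the LQB law `orbit16` («the images of EVERY `U₁` under ANY two restricted `u, u′` lie
on one (4)-orbit») is replaced by what the printed proof uses: p. 281 «The above mapping [the space (18) → configurations U₁U₀ with (19)–(21)] is
one-to-one» — the images `toAxial U₀ U₁ u`, `toAxial U₀ U₁ u′` under two restricted gauge transformations lie on one orbit PROVIDED BOTH LIE IN THE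
SPACE (18) — and the p. 280 gauge-fixing law is asked only for `ε₀ ≤ e` (`e > 0` a threshold of the presentation).  Conclusion verbatim as in the LQB
theorem: `∃ a₀ > 0` (namely `min{e, a₄/(16B₁C₁), c₁/(2C₁), c/(8B₁C₁)}`) such that for `0 < ε₁`, `B₃ε₁ ≤ ε₀ ≤ a₀`, every `V` and every background
`U₀` with (14), the problem (5), (6) has at most one critical orbit.  Proof = the printed p. 296 argument ((122); `one_landau_of_props`) verbatim.
[cite: Balaban1985Variational, Prop. 7 p.299, (122) p.296, Prop. 2 p.281, p.281 («The above mapping is one-to-one»)] -/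
theorem atMostOneCriticalOrbit_of_props_inj {famP : I → VarProblemX} {famD : I → LGData}
    (β : ∀ i, Bridge (famP i) (famD i)) {B₀ B₁ B₃ C₁ c₁ e : ℝ} (he : 0 < e)
    (gaugeFix : ∀ (i : I) (ε₀ ε₁ : ℝ) (V : (famP i).Bdry) (U₀ : (famD i).Cfg) (U : (famP i).Cfg), ε₀ ≤ e →
      (famD i).Sat14 (C₁ * B₃ * ε₁) (C₁ * ε₁) ((β i).bdry V) U₀ → (famP i).InU ε₀ U → (famP i).InB V U →
        ∃ U' : (famD i).Pert, (famD i).In18 ε₀ ((β i).bdry V) U₀ U' ∧ (famP i).SameOrbit U ((β i).emb U₀ U') ∧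
          ((famP i).IsCritical V U → (famD i).Crit ((β i).bdry V) U₀ U'))
    (orbit16w : ∀ (i : I) (ε₀ : ℝ) (V : (famP i).Bdry) (U₀ : (famD i).Cfg) (U₁ : (famD i).Pert) (u u' : (famD i).GT),
      (famD i).Restricted U₀ u → (famD i).Restricted U₀ u' →
        (famD i).In18 ε₀ ((β i).bdry V) U₀ ((famD i).toAxial U₀ U₁ u) → (famD i).In18 ε₀ ((β i).bdry V) U₀ ((famD i).toAxial U₀ U₁ u') →
          (famP i).SameOrbit ((β i).emb U₀ ((famD i).toAxial U₀ U₁ u)) ((β i).emb U₀ ((famD i).toAxial U₀ U₁ u')))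
    (symm : ∀ (i : I) (U U' : (famP i).Cfg), (famP i).SameOrbit U U' → (famP i).SameOrbit U' U)
    (trans : ∀ (i : I) (U U' U'' : (famP i).Cfg), (famP i).SameOrbit U U' → (famP i).SameOrbit U' U'' → (famP i).SameOrbit U U'')
    (hB₁ : 0 < B₁) (hB₃ : 1 ≤ B₃) (hC₁ : 1 ≤ C₁) (hB₀B₁ : B₀ ≤ 4 * B₁) (hc₁ : 0 < c₁)
    (h2 : Prop2Printed B₁ B₃ C₁ c₁ famD) (h5 : Prop5Printed B₁ B₃ C₁ famD) (h6 : Prop6Printed B₀ B₃ C₁ famD) :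
    ∃ a₀ : ℝ, 0 < a₀ ∧ ∀ i : I, ∀ ε₀ ε₁ : ℝ, 0 < ε₁ → ε₀ ≤ a₀ → B₃ * ε₁ ≤ ε₀ →
      ∀ (V : (famP i).Bdry) (U₀ : (famD i).Cfg),
        (famD i).Sat14 (C₁ * B₃ * ε₁) (C₁ * ε₁) ((β i).bdry V) U₀ → (famP i).AtMostOneCriticalOrbit ε₀ V := by
  obtain ⟨c, a₄, hc, ha₄, H⟩ := one_landau_of_props B₀ B₁ B₃ C₁ c₁ famD h2 h5 h6
  have hC₁pos : 0 < C₁ := by linarith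
  set a₀ : ℝ := min e (min (a₄ / (16 * B₁ * C₁)) (min (c₁ / (2 * C₁)) (c / (8 * B₁ * C₁)))) with ha₀def
  have ha₀pos : 0 < a₀ := by
    simp only [ha₀def, lt_min_iff]
    exact ⟨he, by positivity, by positivity, by positivity⟩
  refine ⟨a₀, ha₀pos, ?_⟩
  intro i ε₀ ε₁ hε₁ hε₀a hB₃ε V U₀ h14 U U'' hU hBU hcU hU'' hBU'' hcU''
  have hε₀ : 0 < ε₀ := lt_of_lt_of_le (by nlinarith) hB₃ε
  have hεe : ε₀ ≤ e := le_trans hε₀a (min_le_left _ _)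
  have ha4 : ε₀ ≤ a₄ / (16 * B₁ * C₁) := le_trans hε₀a ((min_le_right _ _).trans (min_le_left _ _))
  have hc1 : ε₀ ≤ c₁ / (2 * C₁) := le_trans hε₀a ((min_le_right _ _).trans ((min_le_right _ _).trans (min_le_left _ _)))
  have hcc : ε₀ ≤ c / (8 * B₁ * C₁) := le_trans hε₀a ((min_le_right _ _).trans ((min_le_right _ _).trans (min_le_right _ _)))
  obtain ⟨hsum, h4c⟩ := silent_restrictions hB₁ hC₁ hB₃ hε₁.le hB₃ε hc1 hcc
  -- ε₂ of p. 296
  set ε₂ : ℝ := B₁ * ε₀ + B₁ * C₁ * B₃ * ε₁ with hε₂def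
  have hε₂ : B₁ * (ε₀ + C₁ * ε₁) ≤ ε₂ := eps2_ge_prop2 hB₁.le hC₁pos.le hB₃ hε₁.le
  have h8 : 8 * ε₂ ≤ a₄ := by
    have h122 := ineq122_le hB₁.le hC₁ hε₀.le hB₃ε
    have : ε₀ * (16 * B₁ * C₁) ≤ a₄ := (le_div_iff₀ (by positivity)).1 ha4
    simp only [hε₂def]; nlinarith
  have h2B : 2 * B₀ * C₁ * B₃ * ε₁ ≤ 8 * ε₂ :=
    second_condition_auto hB₁.le hC₁pos.le (by linarith) hε₀.le hε₁.le hB₀B₁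
  -- reduce both configurations to the space (18)
  obtain ⟨U', hU'18, hUorb, hUcrit⟩ := gaugeFix i ε₀ ε₁ V U₀ U hεe h14 hU hBU
  obtain ⟨U''', hU''18, hU''orb, hU''crit⟩ := gaugeFix i ε₀ ε₁ V U₀ U'' hεe h14 hU'' hBU''
  obtain ⟨U₁, u, u', hu, hu', hax, hax'⟩ :=
    H i ε₀ ε₁ ε₂ hε₀ hε₁ hsum hB₃ε hε₂ h8 h2B h4c ((β i).bdry V) U₀ h14 U' U''' hU'18 (hUcrit hcU) hU''18 (hU''crit hcU'')
  -- print's injectivity: both images lie in (18)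
  have horb : (famP i).SameOrbit ((β i).emb U₀ U') ((β i).emb U₀ U''') := by
    have := orbit16w i ε₀ V U₀ U₁ u u' hu hu' (hax.symm ▸ hU'18) (hax'.symm ▸ hU''18)
    rwa [hax, hax'] at this
  exact trans i _ _ _ hUorb (trans i _ _ _ horb (symm i _ _ hU''orb))

end Generic

/-! ## §2 At the T³ objects: the knit with the conditional axial law and print's injectivity law -/

section T3

variable {L : ℕ}

/-- **PRINT'S «u = u′» LAW IMPLIES THE WEAK ORBIT LAW** at the T³ objects: if two restricted gauge transformations whose images of `U₁U₀` both lie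
in (18) are EQUAL, the images lie on one orbit of the group (4) («lie on one orbit» is reflexive, `T3SectALandauChart.sameOrbit_refl`).
[cite: Balaban1985Variational, p.281 («The above mapping is one-to-one»); Balaban1985Averaging, p.31 («the gauge transformation is uniquely determined by all the conditions»)] -/
theorem sameOrbit_of_eq_law (F : T3Family) {n K : ℕ} (h : n ≤ K) (S : Resid F n K)
    (hinj : ∀ (ε₀ : ℝ) (V : GaugeField (F.P n) 0 (Matrix.specialUnitaryGroup (Fin 2) ℂ))
      (U₀ U₁ : GaugeField (F.P K) 0 (Matrix.specialUnitaryGroup (Fin 2) ℂ)) (u u' : GaugeTransf (F.P K) 0 (Matrix.specialUnitaryGroup (Fin 2) ℂ)),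
      S.Restricted U₀ u → S.Restricted U₀ u' →
        GaugeField.gaugeAct u (emb15 U₀ U₁) ∈ regFibrePr F n K h ε₀ V → S.IsAxial U₀ (GaugeField.gaugeAct u (emb15 U₀ U₁)) →
        GaugeField.gaugeAct u' (emb15 U₀ U₁) ∈ regFibrePr F n K h ε₀ V → S.IsAxial U₀ (GaugeField.gaugeAct u' (emb15 U₀ U₁)) → u = u')
    (ε₀ : ℝ) (V : GaugeField (F.P n) 0 (Matrix.specialUnitaryGroup (Fin 2) ℂ))
    (U₀ U₁ : GaugeField (F.P K) 0 (Matrix.specialUnitaryGroup (Fin 2) ℂ)) (u u' : GaugeTransf (F.P K) 0 (Matrix.specialUnitaryGroup (Fin 2) ℂ))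
    (hu : S.Restricted U₀ u) (hu' : S.Restricted U₀ u')
    (h18 : GaugeField.gaugeAct u (emb15 U₀ U₁) ∈ regFibrePr F n K h ε₀ V ∧ S.IsAxial U₀ (GaugeField.gaugeAct u (emb15 U₀ U₁)))
    (h18' : GaugeField.gaugeAct u' (emb15 U₀ U₁) ∈ regFibrePr F n K h ε₀ V ∧ S.IsAxial U₀ (GaugeField.gaugeAct u' (emb15 U₀ U₁))) :
    T3Thm1Carrier.SameOrbit F n K h (GaugeField.gaugeAct u (emb15 U₀ U₁)) (GaugeField.gaugeAct u' (emb15 U₀ U₁)) := by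
  have e := hinj ε₀ V U₀ U₁ u u' hu hu' h18.1 h18.2 h18'.1 h18'.2
  subst e
  exact sameOrbit_refl F h _

/-- **THE p. 280 REDUCTION TO (18) FROM A CONDITIONAL AXIAL-REPRESENTATIVE LAW** (the `gaugeFix` field of `B11Prop7Assembly.Bridge.Laws` at the
presented carrier `lgData3`, guarded by `ε₀ ≤ e`): if every `U ∈ (6)(ε₀)`, `ε₀ ≤ e`, has a (4)-image in `S.IsAxial U₀ ·` for every background `U₀`
with (14) at radii `(C₁B₃ε₁, C₁ε₁)`, then `U` lies on the orbit of some `U′U₀` with `U′` in (18), critical (reading R2) when `U` is — the image stays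
in (6)(ε₀) (`T3PrintedRegularOrbits.gaugeAct_mem_regFibrePr_iff_of_trivial`) and stays critical (`T3SectALandauChart.isCritR2_gaugeAct_of_trivial`).
[cite: Balaban1985Variational, p.280 (sentence before (18)), (4)-(6) p.278] -/
theorem gaugeFix_of_conditional_axialRepr (F : T3Family) {n K : ℕ} (h : n ≤ K) (S : Resid F n K) {C₁ B₃ e : ℝ}
    (hax : ∀ (ε₀ ε₁ : ℝ) (V : GaugeField (F.P n) 0 (Matrix.specialUnitaryGroup (Fin 2) ℂ))
      (U₀ U : GaugeField (F.P K) 0 (Matrix.specialUnitaryGroup (Fin 2) ℂ)), ε₀ ≤ e →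
      Sat14T3 F n K h (C₁ * B₃ * ε₁) (C₁ * ε₁) V U₀ → U ∈ regFibrePr F n K h ε₀ V →
        ∃ v : GaugeTransf (F.P K) 0 (Matrix.specialUnitaryGroup (Fin 2) ℂ), descTransf F n K h v = (fun _ => 1) ∧ S.IsAxial U₀ (GaugeField.gaugeAct v U))
    (ε₀ ε₁ : ℝ) (V : GaugeField (F.P n) 0 (Matrix.specialUnitaryGroup (Fin 2) ℂ))
    (U₀ U : GaugeField (F.P K) 0 (Matrix.specialUnitaryGroup (Fin 2) ℂ)) (hεe : ε₀ ≤ e)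
    (h14 : (lgData3 F n K h S).Sat14 (C₁ * B₃ * ε₁) (C₁ * ε₁) V U₀)
    (hU : (varProblem3 F n K h).InU ε₀ U) (hB : (varProblem3 F n K h).InB V U) :
    ∃ U' : (lgData3 F n K h S).Pert, (lgData3 F n K h S).In18 ε₀ V U₀ U' ∧ (varProblem3 F n K h).SameOrbit U ((bridge3 F n K h S).emb U₀ U') ∧
      ((varProblem3 F n K h).IsCritical V U → (lgData3 F n K h S).Crit V U₀ U') := by
  have hε₀ : 0 < ε₀ := pos_of_regPr F hU
  have hmem : U ∈ regFibrePr F n K h ε₀ V := (mem_regFibrePr_iff F).mpr ⟨hB, hU⟩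
  obtain ⟨v, hv, hax'⟩ := hax ε₀ ε₁ V U₀ U hεe h14 hmem
  have hmem' : GaugeField.gaugeAct v U ∈ regFibrePr F n K h ε₀ V :=
    (gaugeAct_mem_regFibrePr_iff_of_trivial F h hε₀.le hv U V).mpr hmem
  refine ⟨pert U₀ (GaugeField.gaugeAct v U), ?_, ?_, ?_⟩
  · show emb15 U₀ (pert U₀ (GaugeField.gaugeAct v U)) ∈ regFibrePr F n K h ε₀ V ∧
      S.IsAxial U₀ (emb15 U₀ (pert U₀ (GaugeField.gaugeAct v U)))
    rw [emb15_pert]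
    exact ⟨hmem', hax'⟩
  · show T3Thm1Carrier.SameOrbit F n K h U (emb15 U₀ (pert U₀ (GaugeField.gaugeAct v U)))
    rw [emb15_pert]
    exact ⟨v, hv, rfl⟩
  · intro hcrit
    show IsCritR2 F n K h V (emb15 U₀ (pert U₀ (GaugeField.gaugeAct v U)))
    rw [emb15_pert]
    exact isCritR2_gaugeAct_of_trivial F h hv hcrit

/-- **THE 19200 LEAF V3 FROM PROPOSITIONS 2, 5, 6 AT THE T³ OBJECTS WITH THE WEAK ORBIT LAW** — the corrected twin of
`T3SectALandauChart.prop7From14At_of_props_of_located`, orbit form.  For a block size `L > 1`, a presentation `S` of the residual layer at every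
member, a threshold `e > 0`, the CONDITIONAL axial-representative law (every `U ∈ (6)(ε₀)`, `ε₀ ≤ e`, `U₀` with (14) at radii `(L³B₃ε₁, L³ε₁)`, has a
(4)-image in `S.IsAxial U₀ ·` — [Balaban1985RegularSpaces] p. 79 «The conditions (1.19) determine uniquely an element in each orbit given by the
subgroup (1.14)», asked only in the small-field regime where the averages entering (1.19) are defined), the WEAK ORBIT LAW (two `S.Restricted` gauge
transformations whose images of `U₁U₀` BOTH LIE IN (18) give images on one (4)-orbit — all that p. 296 uses of p. 281 «The above mapping is
one-to-one»), the capped existence leaves and `Prop2Printed ∧ Prop5Printed ∧ Prop6Printed` at `famLG3 L S` (constants as in the LQB knit):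
`T3Thm1CarrierNative.Prop7From14At L B₃`. [cite: Balaban1985Variational, Prop. 7 p.299, Prop. 2 p.281, p.281 («The above mapping is one-to-one»), (122) p.296; Balaban1985RegularSpaces, p.79 (sentence after (1.20))] -/
theorem prop7From14At_of_props_orbitw (hL : 1 < L) (S : ResidFam L) {B₀ B₁ B₃ c₁ O₁ O₂ e₅ e : ℝ} (he : 0 < e)
    (hax : ∀ (i : Idx L) (ε₀ ε₁ : ℝ) (V : GaugeField (i.1.1.P i.1.2.1) 0 (Matrix.specialUnitaryGroup (Fin 2) ℂ))
      (U₀ U : GaugeField (i.1.1.P i.1.2.2) 0 (Matrix.specialUnitaryGroup (Fin 2) ℂ)), ε₀ ≤ e →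
      Sat14T3 i.1.1 i.1.2.1 i.1.2.2 i.2.2.le ((L : ℝ) ^ 3 * B₃ * ε₁) ((L : ℝ) ^ 3 * ε₁) V U₀ →
      U ∈ regFibrePr i.1.1 i.1.2.1 i.1.2.2 i.2.2.le ε₀ V →
        ∃ v : GaugeTransf (i.1.1.P i.1.2.2) 0 (Matrix.specialUnitaryGroup (Fin 2) ℂ),
          descTransf i.1.1 i.1.2.1 i.1.2.2 i.2.2.le v = (fun _ => 1) ∧ (S i).IsAxial U₀ (GaugeField.gaugeAct v U))
    (horb : ∀ (i : Idx L) (ε₀ : ℝ) (V : GaugeField (i.1.1.P i.1.2.1) 0 (Matrix.specialUnitaryGroup (Fin 2) ℂ))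
      (U₀ U₁ : GaugeField (i.1.1.P i.1.2.2) 0 (Matrix.specialUnitaryGroup (Fin 2) ℂ))
      (u u' : GaugeTransf (i.1.1.P i.1.2.2) 0 (Matrix.specialUnitaryGroup (Fin 2) ℂ)),
      (S i).Restricted U₀ u → (S i).Restricted U₀ u' →
        GaugeField.gaugeAct u (emb15 U₀ U₁) ∈ regFibrePr i.1.1 i.1.2.1 i.1.2.2 i.2.2.le ε₀ V ∧
          (S i).IsAxial U₀ (GaugeField.gaugeAct u (emb15 U₀ U₁)) →
        GaugeField.gaugeAct u' (emb15 U₀ U₁) ∈ regFibrePr i.1.1 i.1.2.1 i.1.2.2 i.2.2.le ε₀ V ∧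
          (S i).IsAxial U₀ (GaugeField.gaugeAct u' (emb15 U₀ U₁)) →
        T3Thm1Carrier.SameOrbit i.1.1 i.1.2.1 i.1.2.2 i.2.2.le (GaugeField.gaugeAct u (emb15 U₀ U₁)) (GaugeField.gaugeAct u' (emb15 U₀ U₁)))
    (leaves : ∀ i : Idx L, ExistenceLeavesCap (bridgeFam3 L S i) B₀ B₃ ((L : ℝ) ^ 3) O₁ O₂ e₅)
    (hB₀ : 0 < B₀) (hB₁ : 0 < B₁) (hB₃ : 1 ≤ B₃) (hB₀B₁ : B₀ ≤ 4 * B₁) (hc₁ : 0 < c₁) (hO₁ : 1 ≤ O₁) (hO₂ : 1 ≤ O₂) (he₅ : 0 < e₅)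
    (h2 : Prop2Printed B₁ B₃ ((L : ℝ) ^ 3) c₁ (famLG3 L S)) (h5 : Prop5Printed B₁ B₃ ((L : ℝ) ^ 3) (famLG3 L S))
    (h6 : Prop6Printed B₀ B₃ ((L : ℝ) ^ 3) (famLG3 L S)) :
    Prop7From14At L B₃ := by
  have hL1 : (1 : ℝ) ≤ (L : ℝ) := by exact_mod_cast hL.le
  have hC₁ : (1 : ℝ) ≤ (L : ℝ) ^ 3 := one_le_pow₀ hL1
  have hC₁pos : (0 : ℝ) < (L : ℝ) ^ 3 := by positivity
  -- clause (i) with the weak orbit law and the conditional axial law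
  obtain ⟨a₀, ha₀, HU⟩ := atMostOneCriticalOrbit_of_props_inj (bridgeFam3 L S) he
    (fun i ε₀ ε₁ V U₀ U hεe h14 hU hB =>
      gaugeFix_of_conditional_axialRepr i.1.1 i.2.2.le (S i) (hax i) ε₀ ε₁ V U₀ U hεe h14 hU hB)
    (fun i ε₀ V U₀ U₁ u u' hu hu' h18 h18' => by
      show T3Thm1Carrier.SameOrbit i.1.1 i.1.2.1 i.1.2.2 i.2.2.le (emb15 U₀ (act16 U₀ u U₁)) (emb15 U₀ (act16 U₀ u' U₁))
      have h18a : emb15 U₀ (act16 U₀ u U₁) ∈ regFibrePr i.1.1 i.1.2.1 i.1.2.2 i.2.2.le ε₀ V ∧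
          (S i).IsAxial U₀ (emb15 U₀ (act16 U₀ u U₁)) := h18
      have h18b : emb15 U₀ (act16 U₀ u' U₁) ∈ regFibrePr i.1.1 i.1.2.1 i.1.2.2 i.2.2.le ε₀ V ∧
          (S i).IsAxial U₀ (emb15 U₀ (act16 U₀ u' U₁)) := h18'
      rw [emb15_act16] at h18a h18b
      rw [emb15_act16, emb15_act16]
      exact horb i ε₀ V U₀ U₁ u u' hu hu' h18a h18b)
    (fun i _ _ hUU' => sameOrbit_symm i.1.1 i.2.2.le hUU') (fun i _ _ _ h₁ h₂ => sameOrbit_trans i.1.1 i.2.2.le h₁ h₂)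
    hB₁ hB₃ hC₁ hB₀B₁ hc₁ h2 h5 h6
  -- clause (ii) from Prop. 6 and the capped leaves (no law needed)
  obtain ⟨a₁', ha₁', HE⟩ := exists_minimalOrbit_of_prop6_cap_explicit (bridgeFam3 L S) leaves hB₀ (by linarith) hC₁pos
    (by linarith) (by linarith) he₅ h6
  refine ⟨a₀, a₁', O₂ * O₁, ha₀, ha₁', one_le_mul_of_one_le_of_one_le hO₂ hO₁, ?_⟩
  intro i ε₀ ε₁ hε₁ V _hV U₀ hU₀ hB
  have h14 : (famLG3 L S i).Sat14 ((L : ℝ) ^ 3 * B₃ * ε₁) ((L : ℝ) ^ 3 * ε₁) ((bridgeFam3 L S i).bdry V) U₀ := by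
    obtain ⟨⟨F, n, K⟩, hF, hnK⟩ := i
    exact sat14T3_of_mem_fibre (mul_pos hC₁pos hε₁) hU₀ hB
  refine ⟨fun hε₀a hB₃ε => HU i ε₀ ε₁ hε₁ hε₀a hB₃ε V U₀ h14, fun hε₁a => ?_⟩
  obtain ⟨U, hU⟩ := HE i ε₁ hε₁ hε₁a V U₀ h14
  exact ⟨U, hU⟩

/-- **THE 19200 LEAF V3 FROM PROPOSITIONS 2, 5, 6 AT THE T³ OBJECTS WITH PRINT'S LAWS** («u = u′» form): as `prop7From14At_of_props_orbitw`, the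
orbit law supplied by PRINT'S INJECTIVITY LAW — two `S.Restricted` gauge transformations whose images of `U₁U₀` both lie in (18) are EQUAL
([Balaban1985Variational] p. 281 «The above mapping is one-to-one»; [Balaban1985Averaging] p. 31 «Thus the gauge transformation is uniquely
determined by all the conditions and is given by the formulas (77) for j = k − 1 and by (87)»).  This is the form PROVED for print's presentation in
the sibling file `UnitScaleTiltProp7ChartInjectivityPrint`. [cite: Balaban1985Variational, Prop. 7 p.299, Prop. 2 p.281, p.281 («The above mapping is one-to-one»); Balaban1985Averaging, (87) p.31] -/
theorem prop7From14At_of_props_inj (hL : 1 < L) (S : ResidFam L) {B₀ B₁ B₃ c₁ O₁ O₂ e₅ e : ℝ} (he : 0 < e)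
    (hax : ∀ (i : Idx L) (ε₀ ε₁ : ℝ) (V : GaugeField (i.1.1.P i.1.2.1) 0 (Matrix.specialUnitaryGroup (Fin 2) ℂ))
      (U₀ U : GaugeField (i.1.1.P i.1.2.2) 0 (Matrix.specialUnitaryGroup (Fin 2) ℂ)), ε₀ ≤ e →
      Sat14T3 i.1.1 i.1.2.1 i.1.2.2 i.2.2.le ((L : ℝ) ^ 3 * B₃ * ε₁) ((L : ℝ) ^ 3 * ε₁) V U₀ →
      U ∈ regFibrePr i.1.1 i.1.2.1 i.1.2.2 i.2.2.le ε₀ V →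
        ∃ v : GaugeTransf (i.1.1.P i.1.2.2) 0 (Matrix.specialUnitaryGroup (Fin 2) ℂ),
          descTransf i.1.1 i.1.2.1 i.1.2.2 i.2.2.le v = (fun _ => 1) ∧ (S i).IsAxial U₀ (GaugeField.gaugeAct v U))
    (hinj : ∀ (i : Idx L) (ε₀ : ℝ) (V : GaugeField (i.1.1.P i.1.2.1) 0 (Matrix.specialUnitaryGroup (Fin 2) ℂ))
      (U₀ U₁ : GaugeField (i.1.1.P i.1.2.2) 0 (Matrix.specialUnitaryGroup (Fin 2) ℂ))
      (u u' : GaugeTransf (i.1.1.P i.1.2.2) 0 (Matrix.specialUnitaryGroup (Fin 2) ℂ)),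
      (S i).Restricted U₀ u → (S i).Restricted U₀ u' →
        GaugeField.gaugeAct u (emb15 U₀ U₁) ∈ regFibrePr i.1.1 i.1.2.1 i.1.2.2 i.2.2.le ε₀ V →
        (S i).IsAxial U₀ (GaugeField.gaugeAct u (emb15 U₀ U₁)) →
        GaugeField.gaugeAct u' (emb15 U₀ U₁) ∈ regFibrePr i.1.1 i.1.2.1 i.1.2.2 i.2.2.le ε₀ V →
        (S i).IsAxial U₀ (GaugeField.gaugeAct u' (emb15 U₀ U₁)) → u = u')
    (leaves : ∀ i : Idx L, ExistenceLeavesCap (bridgeFam3 L S i) B₀ B₃ ((L : ℝ) ^ 3) O₁ O₂ e₅)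
    (hB₀ : 0 < B₀) (hB₁ : 0 < B₁) (hB₃ : 1 ≤ B₃) (hB₀B₁ : B₀ ≤ 4 * B₁) (hc₁ : 0 < c₁) (hO₁ : 1 ≤ O₁) (hO₂ : 1 ≤ O₂) (he₅ : 0 < e₅)
    (h2 : Prop2Printed B₁ B₃ ((L : ℝ) ^ 3) c₁ (famLG3 L S)) (h5 : Prop5Printed B₁ B₃ ((L : ℝ) ^ 3) (famLG3 L S))
    (h6 : Prop6Printed B₀ B₃ ((L : ℝ) ^ 3) (famLG3 L S)) :
    Prop7From14At L B₃ :=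
  prop7From14At_of_props_orbitw hL S he hax
    (fun i ε₀ V U₀ U₁ u u' hu hu' h18 h18' => sameOrbit_of_eq_law i.1.1 i.2.2.le (S i) (hinj i) ε₀ V U₀ U₁ u u' hu hu' h18 h18')
    leaves hB₀ hB₁ hB₃ hB₀B₁ hc₁ hO₁ hO₂ he₅ h2 h5 h6

/-! ## §3 Nothing the lineage proved is lost: the LQB inputs still feed the corrected knit -/

/-- The UNCONDITIONAL axial-representative law `T3SectALandauChart.AxialRepr` (proved for the complete comb gauge by gen 7,
`Prop7AxialGauge.axialRepr_comb`) gives the conditional one a fortiori, and the strong LQB law `Orbit16` gives the weak orbit law a fortiori: the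
hypotheses of `T3SectALandauChart.prop7From14At_of_props_of_located` imply those of `prop7From14At_of_props_orbitw` (any threshold, here `e = 1`).
[cite: Balaban1985Variational, Prop. 7 p.299, p.280 (sentence before (18)), p.281 («The above mapping is one-to-one»)] -/
theorem prop7From14At_of_props_orbitw_of_located (hL : 1 < L) (S : ResidFam L) {B₀ B₁ B₃ c₁ O₁ O₂ e₅ : ℝ}
    (hax : ∀ i : Idx L, AxialRepr i.1.1 i.1.2.1 i.1.2.2 i.2.2.le (S i))
    (h16 : ∀ i : Idx L, Orbit16 i.1.1 i.1.2.1 i.1.2.2 i.2.2.le (S i))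
    (leaves : ∀ i : Idx L, ExistenceLeavesCap (bridgeFam3 L S i) B₀ B₃ ((L : ℝ) ^ 3) O₁ O₂ e₅)
    (hB₀ : 0 < B₀) (hB₁ : 0 < B₁) (hB₃ : 1 ≤ B₃) (hB₀B₁ : B₀ ≤ 4 * B₁) (hc₁ : 0 < c₁) (hO₁ : 1 ≤ O₁) (hO₂ : 1 ≤ O₂) (he₅ : 0 < e₅)
    (h2 : Prop2Printed B₁ B₃ ((L : ℝ) ^ 3) c₁ (famLG3 L S)) (h5 : Prop5Printed B₁ B₃ ((L : ℝ) ^ 3) (famLG3 L S))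
    (h6 : Prop6Printed B₀ B₃ ((L : ℝ) ^ 3) (famLG3 L S)) :
    Prop7From14At L B₃ :=
  prop7From14At_of_props_orbitw hL S one_pos (fun i _ _ _ U₀ U _ _ _ => hax i U₀ U)
    (fun i _ _ U₀ U₁ u u' hu hu' _ _ => h16 i U₀ U₁ u u' hu hu') leaves hB₀ hB₁ hB₃ hB₀B₁ hc₁ hO₁ hO₂ he₅ h2 h5 h6

end T3

end Summit.QuantumFields.YangMills.Theorems.Prop7ChartInjectivity

end
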